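import Summits.QuantumFields.YangMills.Theorems.SmallCircleAnchorAnchorGapPeelGaussExpect
import Summits.QuantumFields.YangMills.Theorems.SmallCircleAnchorAnchorGapDopLocality
import Summits.QuantumFields.YangMills.Theorems.SmallCircleAnchorAnchorGapCovMarginal

/-!
# Crux `AnchorGap` (stmt-QuantumFields-11141), line `registered` — THE ATOM-PEELED RECURSION OF THE
# GAUSSIAN EXPECTATION (step (G5e) of GREP's assembly: regrouping the peeled expansion by point set)

From ✓(G5b) `Peel.peel_gaussExpect_prod` (every term of ✓PEEL identified), px5 g17's ✓(G5-loc)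
`DopLocal.foldl_dop_prod_eq_mul` (the line operators of a script with point set `Y` act on `Π_{b∈Y} G b`
only), ✓(G3) `DecPt.gaussExpect_decPt_mul_eq` (factorisation at the decoupled point) and px5 g17's
✓(G5-marg) `CovMarginal.gaussExpect_cov_decPt_eq_cov_pts` (the `Y`-factor is intrinsic):
`E(cov X 1)(Π_{b∈X} G b) = Σ_{Y ⊆ X, r ∈ Y} [Σ_{s rooted at r, valid, pts(s) = Y} ∫ w_s E(cov Y σ_s)(D^s Π_Y G)] · E(cov (X∖Y) 1)(Π_{X∖Y} G)`
(`peeled_recursion`), the singleton bracket `= Z1 r` (`bracket_singleton`), `E(cov ∅ 1)(1) = 1`, and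
`cov univ 1 = C` — the inputs of the resummation ✓`Resum.eq_prod_mul_polymerPartitionFunction`.
GREP's `cov`∕`E`∕`Dop` texts inlined throughout. [folklore]; no definition, no named fact.
-/

set_option autoImplicit false

namespace Summit.QuantumFields.YangMills.Theorems.AnchorGap.Regroup

open Finset MeasureTheory MvPolynomial Literature.Probability.LatticeModels
  Literature.Probability.LatticeModels.BattleFederbush Literature.MeasureTheory.Integral
open scoped Matrix

variable {ι β : Type}

/-- Abstract regrouping of a double sum of script terms by the value of a set-valued label.
[folklore] -/
theorem sum_regroup [Fintype β] [DecidableEq β] {r : β} (N : ℕ) (S : Finset (Finset β))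
    (pts : (k : ℕ) → Script r k → Finset β)
    (ok : (k : ℕ) → Script r k → Prop) [∀ k s, Decidable (ok k s)]
    (A : Finset β → (k : ℕ) → Script r k → ℝ) (B : Finset β → ℝ) :
    ∑ k ∈ Finset.range N, ∑ s : Script r k,
        (if ok k s then (if pts k s ∈ S then A (pts k s) k s * B (pts k s) else 0) else 0)
      = ∑ Y ∈ S, (∑ k ∈ Finset.range N, ∑ s : Script r k,
          if ok k s ∧ pts k s = Y then A Y k s else 0) * B Y := by
  classical
  simp_rw [Finset.sum_mul, ite_mul, zero_mul]
  rw [Finset.sum_comm]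
  refine Finset.sum_congr rfl fun k _ => ?_
  rw [Finset.sum_comm]
  refine Finset.sum_congr rfl fun s _ => ?_
  by_cases hok : ok k s
  · simp only [hok, true_and, if_true]
    rw [← Finset.sum_ite_eq S (pts k s) (fun Y => A Y k s * B Y)]
  · simp [hok]

variable [Fintype ι] [DecidableEq ι] [Fintype β] [DecidableEq β]

/-- **One term, factorised and made intrinsic**: for a valid script `s` with points in `X` and a cube
parameter `t`,
`E(cov X σ_s(t))(D^s Π_{b∈X} G b) = E(cov Y σ_s(t))(D^s Π_{b∈Y} G b) · E(cov (X∖Y) 1)(Π_{b∈X∖Y} G b)`,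
`Y = pts(s)` (✓(G5-loc) + ✓(G3) + ✓(G5-marg) BY NAME). [folklore] -/
theorem term_factor (blk : ι → β) (C : Matrix ι ι ℝ) (hC : C.PosDef) (G : β → (ι → ℝ) → ℝ)
    (hG : ∀ b : β, ContDiff ℝ (⊤ : ℕ∞) (G b))
    (hGl : ∀ (b : β) (φ ψ : ι → ℝ), (∀ i : ι, blk i = b → φ i = ψ i) → G b φ = G b ψ)
    (X : Finset β) {r : β} {k : ℕ} (s : Script r k) (hs : s.Valid) (hX : Finset.univ.image s.y ⊆ X)
    {t : β → ℝ} (ht : t ∈ unitCube β) :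
    ((∫ φ : ι → ℝ, (s.lines.foldl (fun (K : (ι → ℝ) → ℝ) (ℓ : Sym2 β) => fun φ : ι → ℝ =>
            (1 / 2 : ℝ) * ∑ x : ι, ∑ y : ι, if s(blk x, blk y) = ℓ ∧ blk x ≠ blk y
              then C x y * iteratedFDeriv ℝ 2 K φ ![Pi.single x 1, Pi.single y 1] else 0)
            (fun φ : ι → ℝ => ∏ b ∈ X, G b φ)) φ * Real.exp (-(φ ⬝ᵥ ((Matrix.of fun i j : ι => (if blk i = blk j then 1 else if blk i ∈ X ∧ blk j ∈ X then eval t (Script.decPt ℝ s s(blk i, blk j)) else 0) * C i j)⁻¹ *ᵥ φ)) / 2))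
      / ∫ φ : ι → ℝ, Real.exp (-(φ ⬝ᵥ ((Matrix.of fun i j : ι => (if blk i = blk j then 1 else if blk i ∈ X ∧ blk j ∈ X then eval t (Script.decPt ℝ s s(blk i, blk j)) else 0) * C i j)⁻¹ *ᵥ φ)) / 2))
      = ((∫ φ : ι → ℝ, (s.lines.foldl (fun (K : (ι → ℝ) → ℝ) (ℓ : Sym2 β) => fun φ : ι → ℝ =>
            (1 / 2 : ℝ) * ∑ x : ι, ∑ y : ι, if s(blk x, blk y) = ℓ ∧ blk x ≠ blk y
              then C x y * iteratedFDeriv ℝ 2 K φ ![Pi.single x 1, Pi.single y 1] else 0)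
            (fun φ : ι → ℝ => ∏ b ∈ Finset.univ.image s.y, G b φ)) φ * Real.exp (-(φ ⬝ᵥ ((Matrix.of fun i j : ι => (if blk i = blk j then 1 else if blk i ∈ Finset.univ.image s.y ∧ blk j ∈ Finset.univ.image s.y then eval t (Script.decPt ℝ s s(blk i, blk j)) else 0) * C i j)⁻¹ *ᵥ φ)) / 2))
        / ∫ φ : ι → ℝ, Real.exp (-(φ ⬝ᵥ ((Matrix.of fun i j : ι => (if blk i = blk j then 1 else if blk i ∈ Finset.univ.image s.y ∧ blk j ∈ Finset.univ.image s.y then eval t (Script.decPt ℝ s s(blk i, blk j)) else 0) * C i j)⁻¹ *ᵥ φ)) / 2))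
        * ((∫ φ : ι → ℝ, (∏ b ∈ X \ Finset.univ.image s.y, G b φ) * Real.exp (-(φ ⬝ᵥ ((Matrix.of fun i j : ι => (if blk i = blk j then 1 else if blk i ∈ X \ Finset.univ.image s.y ∧ blk j ∈ X \ Finset.univ.image s.y then (1 : ℝ) else 0) * C i j)⁻¹ *ᵥ φ)) / 2))
          / ∫ φ : ι → ℝ, Real.exp (-(φ ⬝ᵥ ((Matrix.of fun i j : ι => (if blk i = blk j then 1 else if blk i ∈ X \ Finset.univ.image s.y ∧ blk j ∈ X \ Finset.univ.image s.y then (1 : ℝ) else 0) * C i j)⁻¹ *ᵥ φ)) / 2)) := by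
  classical
  have hsplit := DopLocal.foldl_dop_prod_eq_mul blk C (fun ℓ F hF => LineDop.dop_contDiff blk C ℓ hF)
    G hG hGl X (Finset.univ.image s.y) hX s rfl
  have hF := DopLocal.seesOnly_foldl_dop_prod blk C (fun ℓ F hF => LineDop.dop_contDiff blk C ℓ hF)
    G hG hGl (Finset.univ.image s.y) s.lines
  have hG' := DopLocal.prod_sdiff_seesOnly_compl blk hGl X (Finset.univ.image s.y)
  have h3 := DecPt.gaussExpect_decPt_mul_eq blk C hC X s hs ht
    (s.lines.foldl (fun (K : (ι → ℝ) → ℝ) (ℓ : Sym2 β) => fun φ : ι → ℝ =>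
            (1 / 2 : ℝ) * ∑ x : ι, ∑ y : ι, if s(blk x, blk y) = ℓ ∧ blk x ≠ blk y
              then C x y * iteratedFDeriv ℝ 2 K φ ![Pi.single x 1, Pi.single y 1] else 0)
            (fun φ : ι → ℝ => ∏ b ∈ Finset.univ.image s.y, G b φ))
    (fun φ : ι → ℝ => ∏ b ∈ X \ Finset.univ.image s.y, G b φ) hF hG'
  have hm := CovMarginal.gaussExpect_cov_decPt_eq_cov_pts blk C hC X s hs ht hX
    (s.lines.foldl (fun (K : (ι → ℝ) → ℝ) (ℓ : Sym2 β) => fun φ : ι → ℝ =>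
            (1 / 2 : ℝ) * ∑ x : ι, ∑ y : ι, if s(blk x, blk y) = ℓ ∧ blk x ≠ blk y
              then C x y * iteratedFDeriv ℝ 2 K φ ![Pi.single x 1, Pi.single y 1] else 0)
            (fun φ : ι → ℝ => ∏ b ∈ Finset.univ.image s.y, G b φ)) hF
  simp only [hsplit]
  rw [h3, hm]

/-- The cube integral of one term: the complementary factor comes out. [folklore] -/
theorem integral_term_factor (blk : ι → β) (C : Matrix ι ι ℝ) (hC : C.PosDef) (G : β → (ι → ℝ) → ℝ)
    (hG : ∀ b : β, ContDiff ℝ (⊤ : ℕ∞) (G b))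
    (hGl : ∀ (b : β) (φ ψ : ι → ℝ), (∀ i : ι, blk i = b → φ i = ψ i) → G b φ = G b ψ)
    (X : Finset β) {r : β} {k : ℕ} (s : Script r k) (hs : s.Valid) (hX : Finset.univ.image s.y ⊆ X) :
    (∫ t in unitCube β, eval t (Script.weight ℝ s) *
        ((∫ φ : ι → ℝ, (s.lines.foldl (fun (K : (ι → ℝ) → ℝ) (ℓ : Sym2 β) => fun φ : ι → ℝ =>
            (1 / 2 : ℝ) * ∑ x : ι, ∑ y : ι, if s(blk x, blk y) = ℓ ∧ blk x ≠ blk y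
              then C x y * iteratedFDeriv ℝ 2 K φ ![Pi.single x 1, Pi.single y 1] else 0)
            (fun φ : ι → ℝ => ∏ b ∈ X, G b φ)) φ * Real.exp (-(φ ⬝ᵥ ((Matrix.of fun i j : ι => (if blk i = blk j then 1 else if blk i ∈ X ∧ blk j ∈ X then eval t (Script.decPt ℝ s s(blk i, blk j)) else 0) * C i j)⁻¹ *ᵥ φ)) / 2))
          / ∫ φ : ι → ℝ, Real.exp (-(φ ⬝ᵥ ((Matrix.of fun i j : ι => (if blk i = blk j then 1 else if blk i ∈ X ∧ blk j ∈ X then eval t (Script.decPt ℝ s s(blk i, blk j)) else 0) * C i j)⁻¹ *ᵥ φ)) / 2)))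
      = (∫ t in unitCube β, eval t (Script.weight ℝ s) *
          ((∫ φ : ι → ℝ, (s.lines.foldl (fun (K : (ι → ℝ) → ℝ) (ℓ : Sym2 β) => fun φ : ι → ℝ =>
            (1 / 2 : ℝ) * ∑ x : ι, ∑ y : ι, if s(blk x, blk y) = ℓ ∧ blk x ≠ blk y
              then C x y * iteratedFDeriv ℝ 2 K φ ![Pi.single x 1, Pi.single y 1] else 0)
            (fun φ : ι → ℝ => ∏ b ∈ Finset.univ.image s.y, G b φ)) φ * Real.exp (-(φ ⬝ᵥ ((Matrix.of fun i j : ι => (if blk i = blk j then 1 else if blk i ∈ Finset.univ.image s.y ∧ blk j ∈ Finset.univ.image s.y then eval t (Script.decPt ℝ s s(blk i, blk j)) else 0) * C i j)⁻¹ *ᵥ φ)) / 2))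
            / ∫ φ : ι → ℝ, Real.exp (-(φ ⬝ᵥ ((Matrix.of fun i j : ι => (if blk i = blk j then 1 else if blk i ∈ Finset.univ.image s.y ∧ blk j ∈ Finset.univ.image s.y then eval t (Script.decPt ℝ s s(blk i, blk j)) else 0) * C i j)⁻¹ *ᵥ φ)) / 2)))
        * ((∫ φ : ι → ℝ, (∏ b ∈ X \ Finset.univ.image s.y, G b φ) * Real.exp (-(φ ⬝ᵥ ((Matrix.of fun i j : ι => (if blk i = blk j then 1 else if blk i ∈ X \ Finset.univ.image s.y ∧ blk j ∈ X \ Finset.univ.image s.y then (1 : ℝ) else 0) * C i j)⁻¹ *ᵥ φ)) / 2))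
          / ∫ φ : ι → ℝ, Real.exp (-(φ ⬝ᵥ ((Matrix.of fun i j : ι => (if blk i = blk j then 1 else if blk i ∈ X \ Finset.univ.image s.y ∧ blk j ∈ X \ Finset.univ.image s.y then (1 : ℝ) else 0) * C i j)⁻¹ *ᵥ φ)) / 2)) := by
  rw [← integral_mul_const]
  refine setIntegral_congr_fun (MeasurableSet.univ_pi fun _ => measurableSet_Icc) fun t ht => ?_
  simp only [mul_assoc]
  rw [term_factor blk C hC G hG hGl X s hs hX ht]

/-- **The atom-peeled recursion.** For `r ∈ X`:
`E(cov X 1)(Π_{b∈X} G b) = Σ_{Y ⊆ X, r ∈ Y} [Σ_{k<|β|} Σ_{s : Script r k, valid, pts(s) = Y} ∫ w_s(t) E(cov Y σ_s(t))(D^s Π_{b∈Y} G b) dt] · E(cov (X∖Y) 1)(Π_{b∈X∖Y} G b)`.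
[folklore] -/
theorem peeled_recursion (blk : ι → β) (C : Matrix ι ι ℝ) (hC : C.PosDef) (G : β → (ι → ℝ) → ℝ)
    (hG : ∀ b : β, ContDiff ℝ (⊤ : ℕ∞) (G b))
    (hGb : ∀ (b : β) (n : ℕ), ∃ (K : ℝ) (m : ℕ), ∀ φ : ι → ℝ,
      ‖iteratedFDeriv ℝ n (G b) φ‖ ≤ K * (1 + ∑ i, φ i ^ 2) ^ m)
    (hGl : ∀ (b : β) (φ ψ : ι → ℝ), (∀ i : ι, blk i = b → φ i = ψ i) → G b φ = G b ψ)
    (X : Finset β) {r : β} (hr : r ∈ X) :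
    ((∫ φ : ι → ℝ, (∏ b ∈ X, G b φ) * Real.exp (-(φ ⬝ᵥ ((Matrix.of fun i j : ι => (if blk i = blk j then 1 else if blk i ∈ X ∧ blk j ∈ X then (1 : ℝ) else 0) * C i j)⁻¹ *ᵥ φ)) / 2))
      / ∫ φ : ι → ℝ, Real.exp (-(φ ⬝ᵥ ((Matrix.of fun i j : ι => (if blk i = blk j then 1 else if blk i ∈ X ∧ blk j ∈ X then (1 : ℝ) else 0) * C i j)⁻¹ *ᵥ φ)) / 2))
      = ∑ Y ∈ X.powerset.filter (fun Y => r ∈ Y),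
          (∑ k ∈ Finset.range (Fintype.card β), ∑ s : Script r k,
            if s.Valid ∧ Finset.univ.image s.y = Y then
              ∫ t in unitCube β, eval t (Script.weight ℝ s) *
                ((∫ φ : ι → ℝ, (s.lines.foldl (fun (K : (ι → ℝ) → ℝ) (ℓ : Sym2 β) => fun φ : ι → ℝ =>
            (1 / 2 : ℝ) * ∑ x : ι, ∑ y : ι, if s(blk x, blk y) = ℓ ∧ blk x ≠ blk y
              then C x y * iteratedFDeriv ℝ 2 K φ ![Pi.single x 1, Pi.single y 1] else 0)
            (fun φ : ι → ℝ => ∏ b ∈ Y, G b φ)) φ * Real.exp (-(φ ⬝ᵥ ((Matrix.of fun i j : ι => (if blk i = blk j then 1 else if blk i ∈ Y ∧ blk j ∈ Y then eval t (Script.decPt ℝ s s(blk i, blk j)) else 0) * C i j)⁻¹ *ᵥ φ)) / 2))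
                  / ∫ φ : ι → ℝ, Real.exp (-(φ ⬝ᵥ ((Matrix.of fun i j : ι => (if blk i = blk j then 1 else if blk i ∈ Y ∧ blk j ∈ Y then eval t (Script.decPt ℝ s s(blk i, blk j)) else 0) * C i j)⁻¹ *ᵥ φ)) / 2))
            else 0)
          * ((∫ φ : ι → ℝ, (∏ b ∈ X \ Y, G b φ) * Real.exp (-(φ ⬝ᵥ ((Matrix.of fun i j : ι => (if blk i = blk j then 1 else if blk i ∈ X \ Y ∧ blk j ∈ X \ Y then (1 : ℝ) else 0) * C i j)⁻¹ *ᵥ φ)) / 2))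
              / ∫ φ : ι → ℝ, Real.exp (-(φ ⬝ᵥ ((Matrix.of fun i j : ι => (if blk i = blk j then 1 else if blk i ∈ X \ Y ∧ blk j ∈ X \ Y then (1 : ℝ) else 0) * C i j)⁻¹ *ᵥ φ)) / 2)) := by
  classical
  have hp :
      ((∫ φ : ι → ℝ, (∏ b ∈ X, G b φ) * Real.exp (-(φ ⬝ᵥ ((Matrix.of fun i j : ι => (if blk i = blk j then 1 else if blk i ∈ X ∧ blk j ∈ X then (1 : ℝ) else 0) * C i j)⁻¹ *ᵥ φ)) / 2))
        / ∫ φ : ι → ℝ, Real.exp (-(φ ⬝ᵥ ((Matrix.of fun i j : ι => (if blk i = blk j then 1 else if blk i ∈ X ∧ blk j ∈ X then (1 : ℝ) else 0) * C i j)⁻¹ *ᵥ φ)) / 2))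
        = ∑ k ∈ Finset.range (Fintype.card β), ∑ s : Script r k,
            if s.Valid then (if Finset.univ.image s.y ⊆ X then
              ∫ t in unitCube β, eval t (Script.weight ℝ s) *
                ((∫ φ : ι → ℝ, (s.lines.foldl (fun (K : (ι → ℝ) → ℝ) (ℓ : Sym2 β) => fun φ : ι → ℝ =>
            (1 / 2 : ℝ) * ∑ x : ι, ∑ y : ι, if s(blk x, blk y) = ℓ ∧ blk x ≠ blk y
              then C x y * iteratedFDeriv ℝ 2 K φ ![Pi.single x 1, Pi.single y 1] else 0)
            (fun φ : ι → ℝ => ∏ b ∈ X, G b φ)) φ * Real.exp (-(φ ⬝ᵥ ((Matrix.of fun i j : ι => (if blk i = blk j then 1 else if blk i ∈ X ∧ blk j ∈ X then eval t (Script.decPt ℝ s s(blk i, blk j)) else 0) * C i j)⁻¹ *ᵥ φ)) / 2))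
                  / ∫ φ : ι → ℝ, Real.exp (-(φ ⬝ᵥ ((Matrix.of fun i j : ι => (if blk i = blk j then 1 else if blk i ∈ X ∧ blk j ∈ X then eval t (Script.decPt ℝ s s(blk i, blk j)) else 0) * C i j)⁻¹ *ᵥ φ)) / 2))
              else 0) else 0 :=
    Peel.peel_gaussExpect_prod blk C hC X hr G hG hGb
  rw [hp]
  refine Eq.trans ?_ (sum_regroup (Fintype.card β) (X.powerset.filter (fun Y => r ∈ Y))
    (fun k (s : Script r k) => Finset.univ.image s.y) (fun k (s : Script r k) => s.Valid)
    (fun Y k (s : Script r k) => ∫ t in unitCube β, eval t (Script.weight ℝ s) *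
      ((∫ φ : ι → ℝ, (s.lines.foldl (fun (K : (ι → ℝ) → ℝ) (ℓ : Sym2 β) => fun φ : ι → ℝ =>
            (1 / 2 : ℝ) * ∑ x : ι, ∑ y : ι, if s(blk x, blk y) = ℓ ∧ blk x ≠ blk y
              then C x y * iteratedFDeriv ℝ 2 K φ ![Pi.single x 1, Pi.single y 1] else 0)
            (fun φ : ι → ℝ => ∏ b ∈ Y, G b φ)) φ * Real.exp (-(φ ⬝ᵥ ((Matrix.of fun i j : ι => (if blk i = blk j then 1 else if blk i ∈ Y ∧ blk j ∈ Y then eval t (Script.decPt ℝ s s(blk i, blk j)) else 0) * C i j)⁻¹ *ᵥ φ)) / 2))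
        / ∫ φ : ι → ℝ, Real.exp (-(φ ⬝ᵥ ((Matrix.of fun i j : ι => (if blk i = blk j then 1 else if blk i ∈ Y ∧ blk j ∈ Y then eval t (Script.decPt ℝ s s(blk i, blk j)) else 0) * C i j)⁻¹ *ᵥ φ)) / 2)))
    (fun Y => ((∫ φ : ι → ℝ, (∏ b ∈ X \ Y, G b φ) * Real.exp (-(φ ⬝ᵥ ((Matrix.of fun i j : ι => (if blk i = blk j then 1 else if blk i ∈ X \ Y ∧ blk j ∈ X \ Y then (1 : ℝ) else 0) * C i j)⁻¹ *ᵥ φ)) / 2))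
        / ∫ φ : ι → ℝ, Real.exp (-(φ ⬝ᵥ ((Matrix.of fun i j : ι => (if blk i = blk j then 1 else if blk i ∈ X \ Y ∧ blk j ∈ X \ Y then (1 : ℝ) else 0) * C i j)⁻¹ *ᵥ φ)) / 2))))
  refine Finset.sum_congr rfl fun k _ => Finset.sum_congr rfl fun s _ => ?_
  by_cases hs : s.Valid
  · rw [if_pos hs, if_pos hs]
    have hiff : Finset.univ.image s.y ∈ X.powerset.filter (fun Y => r ∈ Y)
        ↔ Finset.univ.image s.y ⊆ X := by
      simp only [Finset.mem_filter, Finset.mem_powerset, and_iff_left_iff_imp]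
      exact fun _ => Finset.mem_image.2 ⟨0, Finset.mem_univ _, Script.y_zero s⟩
    by_cases hX : Finset.univ.image s.y ⊆ X
    · rw [if_pos hX, if_pos (hiff.2 hX)]
      exact integral_term_factor blk C hC G hG hGl X s hs hX
    · rw [if_neg hX, if_neg (fun h => hX (hiff.1 h))]
  · rw [if_neg hs, if_neg hs]

omit [Fintype ι] [DecidableEq ι] [Fintype β] in
/-- On a single atom every pair parameter is idle: `cov {r} σ = cov ∅ τ`. [folklore] -/
theorem cov_singleton_eq (blk : ι → β) (C : Matrix ι ι ℝ) (r : β) (f g : ι → ι → ℝ) :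
    (Matrix.of fun i j : ι => (if blk i = blk j then 1 else
        if blk i ∈ ({r} : Finset β) ∧ blk j ∈ ({r} : Finset β) then f i j else 0) * C i j)
      = Matrix.of fun i j : ι => (if blk i = blk j then 1 else
        if blk i ∈ (∅ : Finset β) ∧ blk j ∈ (∅ : Finset β) then g i j else 0) * C i j := by
  ext i j
  simp only [Matrix.of_apply, Finset.mem_singleton, Finset.notMem_empty, false_and, if_false]
  by_cases h : blk i = blk j
  · rw [if_pos h, if_pos h]
  · rw [if_neg h, if_neg h, if_neg]
    rintro ⟨hi, hj⟩
    exact h (hi.trans hj.symm)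

/-- **The singleton bracket is the one-atom partition function**: among the scripts rooted at `r`
only the root script has point set `{r}`, its weight is `1`, it carries no line, and
`E(cov {r} σ)(G r) = E(cov ∅ 0)(G r) = Z1 r`. [folklore] -/
theorem bracket_singleton (blk : ι → β) (C : Matrix ι ι ℝ) (G : β → (ι → ℝ) → ℝ) (r : β) :
    (∑ k ∈ Finset.range (Fintype.card β), ∑ s : Script r k,
        if s.Valid ∧ Finset.univ.image s.y = ({r} : Finset β) then
          ∫ t in unitCube β, eval t (Script.weight ℝ s) *
            ((∫ φ : ι → ℝ, (s.lines.foldl (fun (K : (ι → ℝ) → ℝ) (ℓ : Sym2 β) => fun φ : ι → ℝ =>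
            (1 / 2 : ℝ) * ∑ x : ι, ∑ y : ι, if s(blk x, blk y) = ℓ ∧ blk x ≠ blk y
              then C x y * iteratedFDeriv ℝ 2 K φ ![Pi.single x 1, Pi.single y 1] else 0)
            (fun φ : ι → ℝ => ∏ b ∈ ({r} : Finset β), G b φ)) φ * Real.exp (-(φ ⬝ᵥ ((Matrix.of fun i j : ι => (if blk i = blk j then 1 else if blk i ∈ ({r} : Finset β) ∧ blk j ∈ ({r} : Finset β) then eval t (Script.decPt ℝ s s(blk i, blk j)) else 0) * C i j)⁻¹ *ᵥ φ)) / 2))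
              / ∫ φ : ι → ℝ, Real.exp (-(φ ⬝ᵥ ((Matrix.of fun i j : ι => (if blk i = blk j then 1 else if blk i ∈ ({r} : Finset β) ∧ blk j ∈ ({r} : Finset β) then eval t (Script.decPt ℝ s s(blk i, blk j)) else 0) * C i j)⁻¹ *ᵥ φ)) / 2))
        else 0)
      = ((∫ φ : ι → ℝ, G r φ * Real.exp (-(φ ⬝ᵥ ((Matrix.of fun i j : ι => (if blk i = blk j then 1 else if blk i ∈ (∅ : Finset β) ∧ blk j ∈ (∅ : Finset β) then (0 : ℝ) else 0) * C i j)⁻¹ *ᵥ φ)) / 2))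
        / ∫ φ : ι → ℝ, Real.exp (-(φ ⬝ᵥ ((Matrix.of fun i j : ι => (if blk i = blk j then 1 else if blk i ∈ (∅ : Finset β) ∧ blk j ∈ (∅ : Finset β) then (0 : ℝ) else 0) * C i j)⁻¹ *ᵥ φ)) / 2)) := by
  classical
  have h0 : 0 ∈ Finset.range (Fintype.card β) :=
    Finset.mem_range.2 (Fintype.card_pos_iff.2 ⟨r⟩)
  rw [Finset.sum_eq_single_of_mem 0 h0]
  · rw [Fintype.sum_subsingleton _ (Script.nil : Script r 0)]
    have hv : (Script.nil : Script r 0).Valid := trivial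
    have hpts : Finset.univ.image (Script.nil : Script r 0).y = ({r} : Finset β) := by
      rw [show (Script.nil : Script r 0).y = fun _ => r from rfl]
      exact Finset.image_const Finset.univ_nonempty r
    rw [if_pos ⟨hv, hpts⟩]
    have hw : ∀ t : β → ℝ, eval t (Script.weight ℝ (Script.nil : Script r 0)) = 1 := fun t => by
      simp [Script.weight, Script.wExp]
    have hl : (Script.nil : Script r 0).lines = [] := rfl
    simp only [hw, one_mul, hl, List.foldl_nil, Finset.prod_singleton,
      cov_singleton_eq blk C r _ (fun _ _ => (0 : ℝ))]
    rw [setIntegral_const]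
    simp [Measure.real, volume_unitCube]
  · intro k _ hk
    obtain ⟨k', rfl⟩ := Nat.exists_eq_succ_of_ne_zero hk
    refine Finset.sum_eq_zero fun s _ => ?_
    rw [if_neg]
    rintro ⟨hs, hY⟩
    have hc := Script.card_image_y s hs
    rw [hY, Finset.card_singleton] at hc
    omega

/-- The empty product has expectation `1` (the Gaussian normalisation is positive). [folklore] -/
theorem gaussExpect_empty_one (blk : ι → β) (C : Matrix ι ι ℝ) (hC : C.PosDef)
    (G : β → (ι → ℝ) → ℝ) :
    ((∫ φ : ι → ℝ, (∏ b ∈ (∅ : Finset β), G b φ) * Real.exp (-(φ ⬝ᵥ ((Matrix.of fun i j : ι => (if blk i = blk j then 1 else if blk i ∈ (∅ : Finset β) ∧ blk j ∈ (∅ : Finset β) then (1 : ℝ) else 0) * C i j)⁻¹ *ᵥ φ)) / 2))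
      / ∫ φ : ι → ℝ, Real.exp (-(φ ⬝ᵥ ((Matrix.of fun i j : ι => (if blk i = blk j then 1 else if blk i ∈ (∅ : Finset β) ∧ blk j ∈ (∅ : Finset β) then (1 : ℝ) else 0) * C i j)⁻¹ *ᵥ φ)) / 2)) = 1 := by
  simp only [Finset.prod_empty, one_mul]
  exact div_self (ne_of_gt (GaussSmooth.gaussInt_partition_pos (DecPt.posDef_cov_one blk C hC ∅)))

omit [Fintype ι] [DecidableEq ι] in
/-- With every atom present and all pair parameters `1` the interpolated covariance is `C` itself.
[folklore] -/
theorem cov_univ_one (blk : ι → β) (C : Matrix ι ι ℝ) :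
    (Matrix.of fun i j : ι => (if blk i = blk j then 1 else
        if blk i ∈ (Finset.univ : Finset β) ∧ blk j ∈ (Finset.univ : Finset β) then (1 : ℝ) else 0)
          * C i j) = C := by
  ext i j
  simp [Matrix.of_apply]

end Summit.QuantumFields.YangMills.Theorems.AnchorGap.Regroup
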